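import Summits.AtomisticToContinuum.BoseEinsteinCondensation.Theorems.BECSubharmonicContinuationHarmonicMinorantCoherence
import Summits.AtomisticToContinuum.BoseEinsteinCondensation.Theorems.BECSubharmonicContinuationHarmonicMinorantMeanValue
import Summits.AtomisticToContinuum.BoseEinsteinCondensation.Theses.BECSubharmonicContinuation
import Literature.MathematicalPhysics.QuantumManyBody.PeriodicConfigFourier

/-!
# Route BECSubharmonicContinuation · support `HarmonicMinorant` (stmt-AtomisticToContinuum-9003):
# the continuation lemma (volumetric harmonic minorant)

Real-space (potential-theoretic) proof of the content of
`Summit.AtomisticToContinuum.BoseEinsteinCondensation.Theses.BECSubharmonicContinuation.HarmonicMinorant`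
(the route decl itself was meanwhile closed by the Fourier proof
`CoreContinuationKernel.harmonicMinorant_holds`; this file records the translate form
`harmonicMinorant_translate` and the stronger exact identity `coherence_ballMean_identity`):
for `L > 0`, every periodic trial state `Ψ` of `N` bosons on the torus of side `L`, every particle
`i` and `0 < R ≤ S`,

`1 - ⨍_{B(0,S)} G ≤ (4π)⁻¹∫_{B(0,R)} H(y)/|y| dy + H(0)·R³/S + (4π)⁻¹∫_{R≤|y|≤S} H₊(y)/|y| dy`,

`G(y) = Re ∫_{cell} conj Ψ(X^{i→xᵢ+y})Ψ(X) dX` (translation-averaged one-body density matrix) and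
`H(y) = Re Σ_k ∫_{cell} conj ∂_{i,k}Ψ(X^{i→xᵢ+y}) ∂_{i,k}Ψ(X) dX` (kinetic coherence).

Proof (files I–V of this series): `G ∈ C²(ℝ³)` with `ΔG = -H` (`laplacian_coherence`; Mathlib's
Laplacian `Δ`), `G(0) = 1`, `-H(0) ≤ H`; the volumetric Gauss mean-value identity
`G(0) - ⨍_{B_S} G = ∫_{B_S} H K_S` with `K_S(y) = 1/(4π|y|) - (3S² - |y|²)/(8πS³)`
(`center_sub_ballAverage_eq`); and the kernel bounds `0 ≤ K_S ≤ 1/(4π|y|)`,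
`0 ≤ 1/(4π|y|) - K_S ≤ 3/(8πS)` (`minorant_of_ballMean_identity`, which gives the middle term with
the better constant `R³/(2S)`). The Fourier representation of `G, H` (item 9001) is not used.

## References

* D. Gilbarg, N. S. Trudinger, *Elliptic Partial Differential Equations of Second Order*
  (Springer 2001), Thm 2.1 (mean value), (2.10)–(2.17) (Green's identities and representation)
  [GilbargTrudinger2001].
* E. H. Lieb, R. Seiringer, J. P. Solovej, J. Yngvason, *The Mathematics of the Bose Gas and its
  Condensation* (2005), §1.2 (1.17)–(1.19) (one-body density matrix) [LiebSeiringerSolovejYngvason2005].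
-/

noncomputable section

open MeasureTheory Filter Metric Set Function Real InnerProductSpace
open scoped ComplexConjugate Topology RealInnerProductSpace Laplacian

namespace Summit.AtomisticToContinuum.BoseEinsteinCondensation.Theorems

namespace HarmonicMinorant

open Literature.MathematicalPhysics.QuantumManyBody.BoseGas

/-! ### From the ball-mean identity to the harmonic-minorant estimate -/

/-- The explicit ball kernel `K_S(y) = 1/(4π|y|) - (3S² - |y|²)/(8πS³)` is non-negative and below
the Newtonian kernel on `B_S ∖ {0}`. [folklore] -/
theorem ballKernel_mem_Icc {S : ℝ} (hS : 0 < S) {y : Space} (hy : y ≠ 0) (hyS : ‖y‖ ≤ S) :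
    (4 * Real.pi * ‖y‖)⁻¹ - (3 * S ^ 2 - ‖y‖ ^ 2) / (8 * Real.pi * S ^ 3) ∈
      Icc (0 : ℝ) ((4 * Real.pi * ‖y‖)⁻¹) := by
  rw [← ubp_of_norm_le hyS]
  exact ⟨sub_nonneg.2 (ubp_le_newton hS hy), sub_le_self _ (ubp_nonneg hS y)⟩

/-- The quadratic part `(3S² - |y|²)/(8πS³)` lies in `[0, 3/(8πS)]` on `B_S`. [folklore] -/
theorem quadKernel_mem_Icc {S : ℝ} (hS : 0 < S) {y : Space} (hyS : ‖y‖ ≤ S) :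
    (3 * S ^ 2 - ‖y‖ ^ 2) / (8 * Real.pi * S ^ 3) ∈ Icc (0 : ℝ) (3 / (8 * Real.pi * S)) := by
  rw [← ubp_of_norm_le hyS]
  exact ⟨ubp_nonneg hS y, ubp_le_center hS y⟩

/-- The closed shell `{R ≤ |y| ≤ S}` is measurable. [folklore] -/
theorem measurableSet_shell (R S : ℝ) : MeasurableSet {y : Space | R ≤ ‖y‖ ∧ ‖y‖ ≤ S} :=
  (measurableSet_le measurable_const continuous_norm.measurable).inter
    (measurableSet_le continuous_norm.measurable measurable_const)

/-- **The harmonic-minorant estimate from the ball-mean identity.** If `h` is continuous with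
`-h(0) ≤ h` and `1 - ⨍_{B_S} u = ∫_{B_S} h K_S`, then for `0 < R ≤ S`
`1 - ⨍_{B_S} u ≤ (4π)⁻¹∫_{B_R} h/|y| + h(0)R³/S + (4π)⁻¹∫_{R ≤ |y| ≤ S} h₊/|y|`
(core: `K_S = 1/(4π|y|) - n_S`, `0 ≤ n_S ≤ 3/(8πS)`, `-h ≤ h(0)` give the middle term, even
`R³/(2S)`; shell: `0 ≤ K_S ≤ 1/(4π|y|)`). [folklore] -/
theorem minorant_of_ballMean_identity {u h : Space → ℝ} (hcont : Continuous h) (hlow : ∀ y, -h 0 ≤ h y)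
    {R S : ℝ} (hR : 0 < R) (hRS : R ≤ S)
    (hid : 1 - ⨍ y in ball (0 : Space) S, u y = ∫ y in ball (0 : Space) S,
      h y * ((4 * Real.pi * ‖y‖)⁻¹ - (3 * S ^ 2 - ‖y‖ ^ 2) / (8 * Real.pi * S ^ 3))) :
    1 - (⨍ y in ball (0 : Space) S, u y) ≤
      (4 * Real.pi)⁻¹ * (∫ y in ball (0 : Space) R, h y / ‖y‖) + h 0 * R ^ 3 / S +
        (4 * Real.pi)⁻¹ * (∫ y in {y : Space | R ≤ ‖y‖ ∧ ‖y‖ ≤ S}, max (h y) 0 / ‖y‖) := by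
  have hS : 0 < S := hR.trans_le hRS
  have h0 : 0 ≤ h 0 := by linarith [hlow 0]
  have hpi : 0 < Real.pi := Real.pi_pos
  -- notation-free abbreviations
  set K : Space → ℝ := fun y => (4 * Real.pi * ‖y‖)⁻¹ - (3 * S ^ 2 - ‖y‖ ^ 2) / (8 * Real.pi * S ^ 3)
    with hK
  set nS : Space → ℝ := fun y => (3 * S ^ 2 - ‖y‖ ^ 2) / (8 * Real.pi * S ^ 3) with hnS
  -- a bound for `h` on the closed ball
  obtain ⟨C, hC⟩ := (isCompact_closedBall (0 : Space) S).exists_bound_of_continuousOn hcont.continuousOn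
  have hC0 : 0 ≤ C := (norm_nonneg _).trans (hC 0 (mem_closedBall_self hS.le))
  have hmeasK : Measurable K := by
    refine Measurable.sub (measurable_const.mul continuous_norm.measurable).inv ?_
    exact ((measurable_const.sub (continuous_norm.measurable.pow_const 2)).div measurable_const)
  -- integrability of `h K` on `B_S`
  have hiK : IntegrableOn (fun y => h y * K y) (ball (0 : Space) S) volume := by
    have hdom := (integrable_indicator_iff measurableSet_ball).1 (integrable_dominator C S)
    refine Integrable.mono' hdom (hcont.measurable.mul hmeasK).aestronglyMeasurable ?_
    have hae : ∀ᵐ y ∂(volume : Measure Space), y ≠ (0 : Space) := by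
      rw [ae_iff]
      simp
    filter_upwards [ae_restrict_mem measurableSet_ball, ae_restrict_of_ae hae] with y hy hy0
    have hyS : ‖y‖ ≤ S := le_of_lt (mem_ball_zero_iff.1 hy)
    have hKb := ballKernel_mem_Icc hS hy0 hyS
    rw [norm_mul, Real.norm_eq_abs, Real.norm_eq_abs, abs_of_nonneg hKb.1]
    refine mul_le_mul (hC y (ball_subset_closedBall hy)) (hKb.2.trans ?_) hKb.1 hC0
    have : 0 ≤ 3 / (8 * Real.pi * S) := by positivity
    linarith
  -- Step 1: split `B_S = B_R ∪ (B_S ∖ B_R)`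
  have hsplit : ∫ y in ball (0 : Space) S, h y * K y =
      (∫ y in ball (0 : Space) R, h y * K y) + ∫ y in ball (0 : Space) S \ ball 0 R, h y * K y := by
    rw [setIntegral_sdiff measurableSet_ball hiK (ball_subset_ball hRS)]
    ring
  -- Step 2: the core
  have hiA : IntegrableOn (fun y => h y / ‖y‖) (ball (0 : Space) R) volume := by
    refine integrableOn_ball_of_norm_le_rpow (by rw [finrank_euclideanSpace_fin]; norm_num)
      (C := C) (α := 1) (by rw [finrank_euclideanSpace_fin]; norm_num)
      ?_ (hcont.measurable.div continuous_norm.measurable).aestronglyMeasurable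
    filter_upwards [ae_restrict_mem measurableSet_ball] with y hy
    rw [Real.rpow_neg_one, norm_div, norm_norm, div_eq_mul_inv]
    exact mul_le_mul_of_nonneg_right (hC y (ball_subset_closedBall (ball_subset_ball hRS hy)))
      (inv_nonneg.2 (norm_nonneg _))
  have hiB : IntegrableOn (fun y => h y * nS y) (ball (0 : Space) R) volume :=
    ((hcont.mul (by fun_prop)).continuousOn.integrableOn_compact
      (isCompact_closedBall (0 : Space) R)).mono_set ball_subset_closedBall
  have hcore : ∫ y in ball (0 : Space) R, h y * K y =
      (4 * Real.pi)⁻¹ * (∫ y in ball (0 : Space) R, h y / ‖y‖) - ∫ y in ball (0 : Space) R, h y * nS y := by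
    rw [← integral_const_mul, ← integral_sub (hiA.const_mul _) hiB]
    refine setIntegral_congr_fun measurableSet_ball fun y _ => ?_
    simp only [hK, hnS, mul_inv, div_eq_mul_inv]
    ring
  have hcore2 : -(∫ y in ball (0 : Space) R, h y * nS y) ≤ h 0 * R ^ 3 / S := by
    rw [← integral_neg]
    have hbd : ∀ y ∈ ball (0 : Space) R, -(h y * nS y) ≤ h 0 * (3 / (8 * Real.pi * S)) := by
      intro y hy
      have hyS : ‖y‖ ≤ S := le_of_lt (mem_ball_zero_iff.1 (ball_subset_ball hRS hy))
      have hn := quadKernel_mem_Icc hS hyS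
      calc -(h y * nS y) = (-h y) * nS y := by ring
        _ ≤ h 0 * nS y := mul_le_mul_of_nonneg_right (by linarith [hlow y]) hn.1
        _ ≤ h 0 * (3 / (8 * Real.pi * S)) := mul_le_mul_of_nonneg_left hn.2 h0
    calc ∫ y in ball (0 : Space) R, -(h y * nS y)
        ≤ ∫ y in ball (0 : Space) R, h 0 * (3 / (8 * Real.pi * S)) :=
          setIntegral_mono_on hiB.neg (integrableOn_const (measure_ball_lt_top.ne))
            measurableSet_ball hbd
      _ = h 0 * (3 / (8 * Real.pi * S)) * (4 * Real.pi / 3 * R ^ 3) := by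
          rw [setIntegral_const, volume_real_ball hR.le, smul_eq_mul, mul_comm]
      _ = h 0 * R ^ 3 / (2 * S) := by
          field_simp
          ring
      _ ≤ h 0 * R ^ 3 / S := by
          rw [div_le_div_iff₀ (by positivity) hS]
          nlinarith [mul_nonneg h0 (pow_nonneg hR.le 3), hS]
  -- Step 3: the shell
  have hshell_sub : ball (0 : Space) S \ ball 0 R ⊆ {y : Space | R ≤ ‖y‖ ∧ ‖y‖ ≤ S} := by
    intro y hy
    rw [Set.mem_sdiff, mem_ball_zero_iff, mem_ball_zero_iff, not_lt] at hy
    exact ⟨hy.2, hy.1.le⟩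
  have hshell_bdd : {y : Space | R ≤ ‖y‖ ∧ ‖y‖ ≤ S} ⊆ closedBall (0 : Space) S := fun y hy =>
    mem_closedBall_zero_iff.2 hy.2
  have hiP : IntegrableOn (fun y => max (h y) 0 / ‖y‖) {y : Space | R ≤ ‖y‖ ∧ ‖y‖ ≤ S} volume := by
    refine Measure.integrableOn_of_bounded (M := C / R)
      ((measure_mono hshell_bdd).trans_lt measure_closedBall_lt_top).ne
      ((hcont.max continuous_const).measurable.div continuous_norm.measurable).aestronglyMeasurable
      ?_
    filter_upwards [ae_restrict_mem (measurableSet_shell R S)] with y hy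
    rw [norm_div, norm_norm, Real.norm_eq_abs, abs_of_nonneg (le_max_right _ _)]
    have hyR : R ≤ ‖y‖ := hy.1
    have h1 : max (h y) 0 ≤ C := max_le ((le_abs_self _).trans (hC y (hshell_bdd hy))) hC0
    calc max (h y) 0 / ‖y‖ ≤ C / ‖y‖ := div_le_div_of_nonneg_right h1 (norm_nonneg _)
      _ ≤ C / R := div_le_div_of_nonneg_left hC0 hR hyR
  have hshell : ∫ y in ball (0 : Space) S \ ball 0 R, h y * K y ≤
      (4 * Real.pi)⁻¹ * ∫ y in {y : Space | R ≤ ‖y‖ ∧ ‖y‖ ≤ S}, max (h y) 0 / ‖y‖ := by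
    rw [← integral_const_mul]
    have hiP' := (hiP.mono_set hshell_sub).const_mul (4 * Real.pi)⁻¹
    calc ∫ y in ball (0 : Space) S \ ball 0 R, h y * K y
        ≤ ∫ y in ball (0 : Space) S \ ball 0 R, (4 * Real.pi)⁻¹ * (max (h y) 0 / ‖y‖) := by
          refine setIntegral_mono_on (hiK.mono_set sdiff_subset) hiP'
            (measurableSet_ball.diff measurableSet_ball) fun y hy => ?_
          have hy' := hshell_sub hy
          have hy0 : y ≠ 0 := fun h0 => by
            have h1 : R ≤ ‖y‖ := hy'.1
            rw [h0, norm_zero] at h1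
            linarith
          have hKb := ballKernel_mem_Icc hS hy0 hy'.2
          calc h y * K y ≤ max (h y) 0 * K y :=
                mul_le_mul_of_nonneg_right (le_max_left _ _) hKb.1
            _ ≤ max (h y) 0 * (4 * Real.pi * ‖y‖)⁻¹ :=
                mul_le_mul_of_nonneg_left hKb.2 (le_max_right _ _)
            _ = (4 * Real.pi)⁻¹ * (max (h y) 0 / ‖y‖) := by
                rw [mul_inv, div_eq_mul_inv]; ring
      _ ≤ ∫ y in {y : Space | R ≤ ‖y‖ ∧ ‖y‖ ≤ S}, (4 * Real.pi)⁻¹ * (max (h y) 0 / ‖y‖) := by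
          refine setIntegral_mono_set (hiP.const_mul _) ?_ (Eventually.of_forall hshell_sub)
          filter_upwards [ae_restrict_mem (measurableSet_shell R S)] with y hy
          exact mul_nonneg (by positivity) (div_nonneg (le_max_right _ _) (norm_nonneg _))
  -- Step 4: assemble
  rw [hid, hsplit, hcore]
  linarith

/-! ## Assembly: the continuation lemma for the coherence of a periodic trial state -/

section Assembly


variable {N : ℕ} {L : ℝ} (Ψ : PeriodicTrialState N L) (i : Fin N)

/-- **The real coherence `G(y) = Re ∫ conj Ψ(X + y e_i) Ψ(X) dX` is `C²`.** [folklore] -/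
theorem contDiff_two_coherence (hL : 0 < L) :
    ContDiff ℝ 2 (fun y : Space => (∫ X in cellN N L,
      conj (Ψ.ψ (X + (Pi.single i y : Config N))) * Ψ.ψ X).re) :=
  Complex.reCLM.contDiff.comp (contDiff_two_corr_psi Ψ i hL)

/-- **`ΔG = -H`**: the Laplacian of the coherence is minus the kinetic coherence
`H(y) = Re Σ_k ∫ conj ∂_{i,k}Ψ(X + y e_i) ∂_{i,k}Ψ(X) dX`. [folklore] -/
theorem laplacian_coherence (hL : 0 < L) (y : Space) :
    (Δ (fun y : Space => (∫ X in cellN N L,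
      conj (Ψ.ψ (X + (Pi.single i y : Config N))) * Ψ.ψ X).re)) y =
      -(∑ k : Fin 3, ∫ X in cellN N L,
        conj (fderiv ℝ Ψ.ψ (X + (Pi.single i y : Config N))
          (Pi.single i (EuclideanSpace.single k (1 : ℝ))))
        * fderiv ℝ Ψ.ψ X (Pi.single i (EuclideanSpace.single k (1 : ℝ)))).re := by
  have hP := contDiff_two_corr_psi Ψ i hL
  have h1 : (fun y : Space => (∫ X in cellN N L,
      conj (Ψ.ψ (X + (Pi.single i y : Config N))) * Ψ.ψ X).re) =
      (Complex.reCLM : ℂ →L[ℝ] ℝ) ∘ (fun y : Space => ∫ X in cellN N L,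
        conj (Ψ.ψ (X + (Pi.single i y : Config N))) * Ψ.ψ X) := rfl
  rw [h1, ContDiffAt.laplacian_CLM_comp_left hP.contDiffAt]
  simp only [Function.comp_apply, Complex.reCLM_apply]
  rw [Literature.Analysis.FluidPDE.laplacian_eq_sum_fderiv_fderiv (EuclideanSpace.basisFun (Fin 3) ℝ) hP y]
  rw [← Complex.neg_re, ← Finset.sum_neg_distrib]
  congr 1
  refine Finset.sum_congr rfl fun k _ => ?_
  rw [show (EuclideanSpace.basisFun (Fin 3) ℝ) k = EuclideanSpace.single k (1 : ℝ) from
    EuclideanSpace.basisFun_apply _ _ _, fderiv_fderiv_corr_psi Ψ i hL]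

/-- Continuity of the kinetic coherence `H(y) = Re Σ_k ∫ conj ∂_{i,k}Ψ(X + y e_i) ∂_{i,k}Ψ(X) dX`.
[folklore] -/
theorem continuous_kineticCoherence :
    Continuous (fun y : Space => (∑ k : Fin 3, ∫ X in cellN N L,
        conj (fderiv ℝ Ψ.ψ (X + (Pi.single i y : Config N))
          (Pi.single i (EuclideanSpace.single k (1 : ℝ))))
        * fderiv ℝ Ψ.ψ X (Pi.single i (EuclideanSpace.single k (1 : ℝ)))).re) :=
  Complex.continuous_re.comp (continuous_finsetSum _ fun _ _ =>
    continuous_corr i (continuous_fderiv_psi Ψ _) (continuous_fderiv_psi Ψ _))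

end Assembly

/-- **The ball-mean identity for the coherence of a periodic trial state** (the exact form behind
the continuation lemma `HarmonicMinorant`, item stmt-AtomisticToContinuum-9003): for `L > 0`,
every periodic trial state `Ψ`, every particle `i` and `S > 0`,
`1 - ⨍_{B(0,S)} G = ∫_{B(0,S)} H(y) (1/(4π|y|) - (3S² - |y|²)/(8πS³)) dy`,
with `G(y) = Re ∫ conj Ψ(X + y e_i) Ψ(X) dX` and `H(y) = Re Σ_k ∫ conj ∂_{i,k}Ψ(X + y e_i) ∂_{i,k}Ψ(X) dX`
(`ΔG = -H`, `G(0) = 1` and the volumetric Gauss mean-value identity). The inequality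
`HarmonicMinorant` follows by `minorant_of_ballMean_identity` (with `abs_kineticCoherence_le`);
it is already in the tree as `CoreContinuationKernel.harmonicMinorant_holds` (Fourier proof), so only
the identity is recorded here. [cite: GilbargTrudinger2001, Thm 2.1] -/
theorem coherence_ballMean_identity {N : ℕ} {L : ℝ} (hL : 0 < L) (Ψ : PeriodicTrialState N L) (i : Fin N) {S : ℝ}
    (hS : 0 < S) :
    1 - (⨍ y in ball (0 : Space) S, (∫ X in cellN N L,
        conj (Ψ.ψ (X + (Pi.single i y : Config N))) * Ψ.ψ X).re) =
      ∫ y in ball (0 : Space) S, (∑ k : Fin 3, ∫ X in cellN N L,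
        conj (fderiv ℝ Ψ.ψ (X + (Pi.single i y : Config N)) (Pi.single i (EuclideanSpace.single k (1 : ℝ))))
          * fderiv ℝ Ψ.ψ X (Pi.single i (EuclideanSpace.single k (1 : ℝ)))).re *
        ((4 * Real.pi * ‖y‖)⁻¹ - (3 * S ^ 2 - ‖y‖ ^ 2) / (8 * Real.pi * S ^ 3)) := by
  have hu2 := contDiff_two_coherence Ψ i hL
  have key := center_sub_ballAverage_eq hS hu2
  beta_reduce at key
  rw [re_corr_psi_zero Ψ i] at key
  rw [key]
  refine setIntegral_congr_fun measurableSet_ball fun y _ => ?_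
  beta_reduce
  rw [laplacian_coherence Ψ i hL y, neg_neg]

/-- **The continuation lemma in translate form** (real-space proof): for `L > 0`, every periodic trial
state `Ψ`, every `i` and `0 < R ≤ S`,
`1 - ⨍_{B(0,S)} G ≤ (4π)⁻¹∫_{B(0,R)} H/|y| + H(0)R³/S + (4π)⁻¹∫_{R≤|y|≤S} H₊/|y|`, with `G, H` written
with the translate `X + y e_i` (the route decl `HarmonicMinorant` uses `Function.update X i (X i + y)`,
equal by `update_eq_add_single`; that form is `CoreContinuationKernel.harmonicMinorant_holds`).
[cite: GilbargTrudinger2001, Thm 2.1] -/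
theorem harmonicMinorant_translate {N : ℕ} {L : ℝ} (hL : 0 < L) (Ψ : PeriodicTrialState N L) (i : Fin N) {R S : ℝ}
    (hR : 0 < R) (hRS : R ≤ S) :
    1 - (⨍ y in ball (0 : Space) S, (∫ X in cellN N L,
        conj (Ψ.ψ (X + (Pi.single i y : Config N))) * Ψ.ψ X).re) ≤
      (4 * Real.pi)⁻¹ * (∫ y in ball (0 : Space) R, (∑ k : Fin 3, ∫ X in cellN N L,
        conj (fderiv ℝ Ψ.ψ (X + (Pi.single i y : Config N)) (Pi.single i (EuclideanSpace.single k (1 : ℝ))))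
          * fderiv ℝ Ψ.ψ X (Pi.single i (EuclideanSpace.single k (1 : ℝ)))).re / ‖y‖) +
      (∑ k : Fin 3, ∫ X in cellN N L,
        conj (fderiv ℝ Ψ.ψ (X + (Pi.single i (0 : Space) : Config N))
          (Pi.single i (EuclideanSpace.single k (1 : ℝ))))
          * fderiv ℝ Ψ.ψ X (Pi.single i (EuclideanSpace.single k (1 : ℝ)))).re * R ^ 3 / S +
      (4 * Real.pi)⁻¹ * (∫ y in {y : Space | R ≤ ‖y‖ ∧ ‖y‖ ≤ S}, max ((∑ k : Fin 3, ∫ X in cellN N L,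
        conj (fderiv ℝ Ψ.ψ (X + (Pi.single i y : Config N)) (Pi.single i (EuclideanSpace.single k (1 : ℝ))))
          * fderiv ℝ Ψ.ψ X (Pi.single i (EuclideanSpace.single k (1 : ℝ)))).re) 0 / ‖y‖) := by
  have hS : 0 < S := hR.trans_le hRS
  set h : Space → ℝ := fun y => (∑ k : Fin 3, ∫ X in cellN N L,
    conj (fderiv ℝ Ψ.ψ (X + (Pi.single i y : Config N)) (Pi.single i (EuclideanSpace.single k (1 : ℝ))))
      * fderiv ℝ Ψ.ψ X (Pi.single i (EuclideanSpace.single k (1 : ℝ)))).re with hh_def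
  have hcont : Continuous h := continuous_kineticCoherence Ψ i
  have hlow : ∀ y, -h 0 ≤ h y := by
    intro y
    have hb := abs_kineticCoherence_le Ψ i hL y
    have h0 : h 0 = (∑ k : Fin 3, ∫ X in cellN N L,
        conj (fderiv ℝ Ψ.ψ X (Pi.single i (EuclideanSpace.single k (1 : ℝ))))
          * fderiv ℝ Ψ.ψ X (Pi.single i (EuclideanSpace.single k (1 : ℝ)))).re := by
      simp only [hh_def, Pi.single_zero, add_zero]
    rw [← h0] at hb
    exact (abs_le.1 hb).1
  exact minorant_of_ballMean_identity hcont hlow hR hRS (coherence_ballMean_identity hL Ψ i hS)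

end HarmonicMinorant

end Summit.AtomisticToContinuum.BoseEinsteinCondensation.Theorems
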